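import Summits.CriticalPhenomena.PercolationContinuityZ3.Theorems.Transplant.FKConnectivityAllQForestContractionMono
import HarnessLib

/-!
# DOUBLE PAIRS HALVE: two free pairs parallel in the quotient carry exactly one pair per class, and every exchange-invariant forest fibre
# count on `(M, u₀)` is twice the count on the fibre with one of them pinned and the other deleted

Support file (`--supports stmt-CriticalPhenomena-4575`), FK sub-lane `prim-bschramm-fk-1` (gen 25) of the post-continuity programme;
builds on p205010 (kernel theorem, internal audit signed; external expert review pending).  No definitions, no named facts, no sorries;
standard axioms.  This is identity F4d of the induction architecture "AAM ⇒ (★) ⇒ (♣)⁰" (memo bschramm/FROM-fk-1-g25-HUB-PAIR-DECOMPOSITION.md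
§6, §6c): in the absorption descent a neighbour `z` joined to `a` by TWO pairs is absorbed by the identity below instead of by the monotonicity AAM.

SETTING.  Fibre `(M, u₀)`; two distinct free pairs `h = a₁z₁`, `h' = a₂z₂ ∈ M` PARALLEL IN THE QUOTIENT (`a₁ ~ a₂`, `z₁ ~ z₂` pinned).
* `not_both_of_quotParallel`: a forest class containing the pinned pairs never holds both (so a colouring has exactly one per class);
* `reachable_exchange_quotParallel`, `isForestCfg_exchange_quotParallel`, `reach_iff_exchange_quotParallel`: the exchange `h' → h` in a class
  containing the pinned pairs preserves reachability and forest-ness;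
* **`fibreCount_eq_two_mul_of_quotParallel`**: for events `P, Q ⊆ Fo` invariant under the exchanges,
  `#_{(M,u₀)}(P, Q) = 2 · #_{(M ∖ {h,h'}, u₀ ∪ {h})}(P, Q)` (colourings with `h` first map identically, those with `h'` first by the exchange);
* **`hubPair_counts_eq_two_mul_of_quotParallel`**: the four one-class counts at `(o,a)` (events `Fo ∩ P₀ ∩ {o ~ a}` / `Fo ∩ Q₀ ∩ {o ≁ a}`, `P₀, Q₀`
  among `univ, {e ∈ ·}, {f ∈ ·}, {e,f ∈ ·}`, `e,f ∉ {h,h'}`) halve: in graph language `s_T(G) = 2·s_T(G/{h,h'})` for every type `T`.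
[cite: SempleWelsh2008, Conj. 1.1 (p. 2)] [cite: CibulkaHladkyLaCroixWagner2008, Thm. 1 (p. 2)] [cite: Linusson2011, Prop. 2.6] [cite: Grimmett2006, §1.5 (p. 13)]
-/

noncomputable section

namespace Summit.CriticalPhenomena.PercolationContinuityZ3.Theorems
namespace FK

open Set Literature.Probability.LatticeModels Literature.Probability.Percolation
open scoped Classical symmDiff

variable {V : Type*} [Fintype V]

section QuotParallel

variable {u₀ : BondConfig V} {a₁ z₁ a₂ z₂ : V}

omit [Fintype V] in
/-- Two quotient-parallel pairs are never together in a forest class containing the pinned pairs. [cite: Grimmett2006, §1.5 (p. 13)] -/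
theorem not_both_of_quotParallel {β : BondConfig V} (hsub : u₀ ⊆ β) (hF : IsForestCfg β)
    (ha : (openGraph u₀).Reachable a₁ a₂) (hz : (openGraph u₀).Reachable z₁ z₂) (h1 : a₁ ≠ z₁) (h2 : a₂ ≠ z₂)
    (hne : s(a₂, z₂) ≠ s(a₁, z₁)) (hu : s(a₂, z₂) ∉ u₀) (hh : s(a₁, z₁) ∈ β) : s(a₂, z₂) ∉ β := by
  intro hh'
  have hsub' : insert s(a₁, z₁) u₀ ⊆ β \ {s(a₂, z₂)} := by
    rintro p (rfl | hp)
    · exact ⟨hh, fun h => hne (mem_singleton_iff.1 h).symm⟩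
    · exact ⟨hsub hp, fun h => hu ((mem_singleton_iff.1 h) ▸ hp)⟩
  have hmono : openGraph u₀ ≤ openGraph (β \ {s(a₂, z₂)}) := openGraph_mono fun p hp => hsub' (mem_insert_of_mem _ hp)
  have hr : (openGraph (β \ {s(a₂, z₂)})).Reachable a₂ z₂ :=
    ((ha.mono hmono).symm.trans ((openGraph_adj _ _ _).2 ⟨hsub' (mem_insert _ _), h1⟩).reachable).trans (hz.mono hmono)
  have hback : insert s(a₂, z₂) (β \ {s(a₂, z₂)}) = β := by rw [insert_sdiff_singleton, insert_eq_of_mem hh']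
  have hF' : IsForestCfg (insert s(a₂, z₂) (β \ {s(a₂, z₂)})) := by rw [hback]; exact hF
  exact ((isForestCfg_insert_iff h2 (fun h => h.2 rfl)).1 hF').2 hr

omit [Fintype V] in
/-- Exchanging `h' = a₂z₂ → h = a₁z₁` in a class containing the pinned pairs preserves reachability between any two vertices.
[cite: Grimmett2006, §1.5 (p. 13)] -/
theorem reachable_exchange_quotParallel {β : BondConfig V} (hsub : u₀ ⊆ β)
    (ha : (openGraph u₀).Reachable a₁ a₂) (hz : (openGraph u₀).Reachable z₁ z₂) (h1 : a₁ ≠ z₁)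
    (hu' : s(a₂, z₂) ∉ u₀) (x w : V) (hr : (openGraph β).Reachable x w) :
    (openGraph (insert s(a₁, z₁) (β \ {s(a₂, z₂)}))).Reachable x w := by
  set β' := insert s(a₁, z₁) (β \ {s(a₂, z₂)}) with hβ'
  have hsub' : u₀ ⊆ β' := fun p hp => mem_insert_of_mem _ ⟨hsub hp, fun h => hu' ((mem_singleton_iff.1 h) ▸ hp)⟩
  have hmono : openGraph u₀ ≤ openGraph β' := openGraph_mono hsub'
  have hdet : (openGraph β').Reachable a₂ z₂ :=
    ((ha.mono hmono).symm.trans ((openGraph_adj _ _ _).2 ⟨mem_insert _ _, h1⟩).reachable).trans (hz.mono hmono)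
  obtain ⟨p⟩ := hr
  suffices H : ∀ (b c : V) (q : (openGraph β).Walk b c), (openGraph β').Reachable b c from H x w p
  intro b c q
  induction q with
  | nil => exact SimpleGraph.Reachable.refl _
  | @cons b c d hadj q' ih =>
    have hbc := (openGraph_adj β b c).1 hadj
    refine SimpleGraph.Reachable.trans ?_ ih
    by_cases hp : s(b, c) = s(a₂, z₂)
    · rcases Sym2.eq_iff.1 hp with ⟨rfl, rfl⟩ | ⟨rfl, rfl⟩
      · exact hdet
      · exact hdet.symm
    · exact ((openGraph_adj β' b c).2 ⟨mem_insert_of_mem _ ⟨hbc.1, fun h => hp (mem_singleton_iff.1 h)⟩, hbc.2⟩).reachable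

omit [Fintype V] in
/-- Exchanging `h' → h` in a forest class containing the pinned pairs and `h'` (but not `h`) gives a forest. [cite: Grimmett2006, §1.5 (p. 13)] -/
theorem isForestCfg_exchange_quotParallel {β : BondConfig V} (hsub : u₀ ⊆ β) (hF : IsForestCfg β)
    (ha : (openGraph u₀).Reachable a₁ a₂) (hz : (openGraph u₀).Reachable z₁ z₂) (h1 : a₁ ≠ z₁) (h2 : a₂ ≠ z₂)
    (hu' : s(a₂, z₂) ∉ u₀) (hh : s(a₁, z₁) ∉ β) (hh' : s(a₂, z₂) ∈ β) :
    IsForestCfg (insert s(a₁, z₁) (β \ {s(a₂, z₂)})) := by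
  refine (isForestCfg_insert_iff h1 (fun h => hh h.1)).2 ⟨⟨fun p hp => hF.1 p hp.1, hF.2.anti (openGraph_mono sdiff_subset)⟩, fun hr => ?_⟩
  have hsub' : u₀ ⊆ β \ {s(a₂, z₂)} := fun p hp => ⟨hsub hp, fun h => hu' ((mem_singleton_iff.1 h) ▸ hp)⟩
  have hmono : openGraph u₀ ≤ openGraph (β \ {s(a₂, z₂)}) := openGraph_mono hsub'
  have hr' : (openGraph (β \ {s(a₂, z₂)})).Reachable a₂ z₂ := ((ha.mono hmono).symm.trans hr).trans (hz.mono hmono)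
  have hback : insert s(a₂, z₂) (β \ {s(a₂, z₂)}) = β := by rw [insert_sdiff_singleton, insert_eq_of_mem hh']
  have hF' : IsForestCfg (insert s(a₂, z₂) (β \ {s(a₂, z₂)})) := by rw [hback]; exact hF
  exact ((isForestCfg_insert_iff h2 (fun h => h.2 rfl)).1 hF').2 hr'

end QuotParallel

/-! ### Set bookkeeping for the two maps -/

section Sets

variable {M u₀ ω : BondConfig V} {h h' : Sym2 V}

omit [Fintype V] in
/-- A configuration of `(M, u₀)` holding `h` but not `h'` is a configuration of `(M ∖ {h,h'}, u₀ ∪ {h})`, with partner = old partner exchanged.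
[folklore] -/
theorem quotParallel_sets_id (_hd : Disjoint u₀ M) (hhM : h ∈ M) (hh'M : h' ∈ M) (hω : ω \ M = u₀) (hh : h ∈ ω) (hh' : h' ∉ ω) :
    ω \ (M \ {h, h'}) = insert h u₀ ∧ ω ∆ (M \ {h, h'}) = insert h ((ω ∆ M) \ {h'}) := by
  have hωM : ∀ p, p ∈ ω → p ∉ M → p ∈ u₀ := fun p hp hq => by
    have : p ∈ ω \ M := ⟨hp, hq⟩; rwa [hω] at this
  have hu₀ : ∀ p, p ∈ u₀ → p ∈ ω ∧ p ∉ M := fun p hp => by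
    have : p ∈ ω \ M := by rw [hω]; exact hp
    exact this
  constructor
  · ext p
    simp only [mem_sdiff, mem_insert_iff, mem_singleton_iff, not_and, not_not]
    constructor
    · rintro ⟨hpω, hpn⟩
      by_cases hpM : p ∈ M
      · rcases hpn hpM with hp | hp
        · exact Or.inl hp
        · exact absurd hpω (hp ▸ hh')
      · exact Or.inr (hωM p hpω hpM)
    · rintro (rfl | hpu)
      · exact ⟨hh, fun _ => Or.inl rfl⟩
      · exact ⟨(hu₀ p hpu).1, fun hpM => absurd hpM (hu₀ p hpu).2⟩
  · ext p
    simp only [Set.mem_symmDiff, mem_sdiff, mem_insert_iff, mem_singleton_iff, not_and, not_not]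
    constructor
    · rintro (⟨hpω, hpn⟩ | ⟨⟨hpM, hpn⟩, hpω⟩)
      · by_cases hpM : p ∈ M
        · rcases hpn hpM with hp | hp
          · exact Or.inl hp
          · exact absurd hpω (hp ▸ hh')
        · exact Or.inr ⟨Or.inl ⟨hpω, hpM⟩, fun hp => hpM (hp ▸ hh'M)⟩
      · refine Or.inr ⟨Or.inr ⟨hpM, hpω⟩, fun hp => hpn (Or.inr hp)⟩
    · rintro (rfl | ⟨⟨hpω, hpM⟩ | ⟨hpM, hpω⟩, hpn⟩)
      · exact Or.inl ⟨hh, fun _ => Or.inl rfl⟩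
      · exact Or.inl ⟨hpω, fun hpM' => absurd hpM' hpM⟩
      · exact Or.inr ⟨⟨hpM, fun hp => hp.elim (fun hp => hpω (hp ▸ hh)) hpn⟩, hpω⟩

omit [Fintype V] in
/-- A configuration of `(M, u₀)` holding `h'` but not `h`, exchanged (`h' → h`), is a configuration of `(M ∖ {h,h'}, u₀ ∪ {h})` with the SAME
partner. [folklore] -/
theorem quotParallel_sets_exch (_hd : Disjoint u₀ M) (hhM : h ∈ M) (hh'M : h' ∈ M) (hne : h' ≠ h) (hω : ω \ M = u₀) (hh : h ∉ ω)
    (hh' : h' ∈ ω) :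
    insert h (ω \ {h'}) \ (M \ {h, h'}) = insert h u₀ ∧ (insert h (ω \ {h'})) ∆ (M \ {h, h'}) = ω ∆ M ∧
      insert h' (insert h (ω \ {h'}) \ {h}) = ω := by
  have hωM : ∀ p, p ∈ ω → p ∉ M → p ∈ u₀ := fun p hp hq => by
    have : p ∈ ω \ M := ⟨hp, hq⟩; rwa [hω] at this
  have hu₀ : ∀ p, p ∈ u₀ → p ∈ ω ∧ p ∉ M := fun p hp => by
    have : p ∈ ω \ M := by rw [hω]; exact hp
    exact this
  refine ⟨?_, ?_, ?_⟩
  · ext p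
    simp only [mem_sdiff, mem_insert_iff, mem_singleton_iff, not_and, not_not]
    constructor
    · rintro ⟨hp | ⟨hpω, hpn'⟩, hpn⟩
      · exact Or.inl hp
      · by_cases hpM : p ∈ M
        · rcases hpn hpM with hp | hp
          · exact Or.inl hp
          · exact absurd hp hpn'
        · exact Or.inr (hωM p hpω hpM)
    · rintro (rfl | hpu)
      · exact ⟨Or.inl rfl, fun _ => Or.inl rfl⟩
      · refine ⟨Or.inr ⟨(hu₀ p hpu).1, fun hp => (hu₀ p hpu).2 (hp ▸ hh'M)⟩, fun hpM => absurd hpM (hu₀ p hpu).2⟩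
  · ext p
    simp only [Set.mem_symmDiff, mem_sdiff, mem_insert_iff, mem_singleton_iff]
    constructor
    · rintro (⟨hp1, hp2⟩ | ⟨⟨hpM, hpn⟩, hp2⟩)
      · rcases hp1 with hp | ⟨hpω, hpn'⟩
        · subst hp; exact Or.inr ⟨hhM, hh⟩
        · by_cases hpM : p ∈ M
          · exfalso; apply hp2; exact ⟨hpM, fun hx => hx.elim (fun hx => hh (hx ▸ hpω)) hpn'⟩
          · exact Or.inl ⟨hpω, hpM⟩
      · refine Or.inr ⟨hpM, fun hpω => hp2 (Or.inr ⟨hpω, fun hx => hpn (Or.inr hx)⟩)⟩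
    · rintro (⟨hpω, hpM⟩ | ⟨hpM, hpω⟩)
      · exact Or.inl ⟨Or.inr ⟨hpω, fun hx => hpM (hx ▸ hh'M)⟩, fun hx => hpM hx.1⟩
      · by_cases hp : p = h
        · subst hp
          exact Or.inl ⟨Or.inl rfl, fun hx => hx.2 (Or.inl rfl)⟩
        · have hp' : p ≠ h' := fun hx => hpω (hx ▸ hh')
          exact Or.inr ⟨⟨hpM, fun hx => hx.elim hp hp'⟩, fun hx => hx.elim hp fun hx => hpω hx.1⟩
  · have h1 : insert h (ω \ {h'}) \ {h} = ω \ {h'} := insert_sdiff_self_of_notMem fun hx => hh hx.1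
    rw [h1, insert_sdiff_singleton, insert_eq_of_mem hh']

omit [Fintype V] in
/-- Backwards: a configuration of `(M ∖ {h,h'}, u₀ ∪ {h})` is a configuration of `(M, u₀)` holding `h`, not `h'`; and its partner exchanged
back (`h → h'`) is the `(M,u₀)`-partner. [folklore] -/
theorem quotParallel_sets_back (hd : Disjoint u₀ M) (hhM : h ∈ M) (hh'M : h' ∈ M) (hne : h' ≠ h) (hω : ω \ (M \ {h, h'}) = insert h u₀) :
    h ∈ ω ∧ h' ∉ ω ∧ ω \ M = u₀ ∧ ω ∆ M = insert h' ((ω ∆ (M \ {h, h'})) \ {h}) ∧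
      (insert h' (ω \ {h})) \ M = u₀ ∧ (insert h' (ω \ {h})) ∆ M = ω ∆ (M \ {h, h'}) ∧
      insert h (insert h' (ω \ {h}) \ {h'}) = ω := by
  have hu : h ∉ u₀ := fun hx => hd.le_bot ⟨hx, hhM⟩
  have hu' : h' ∉ u₀ := fun hx => hd.le_bot ⟨hx, hh'M⟩
  have hmem : ∀ p, (p ∈ ω ∧ p ∉ M \ {h, h'}) ↔ (p = h ∨ p ∈ u₀) := fun p => by
    have := Set.ext_iff.1 hω p
    simp only [mem_sdiff, mem_insert_iff] at this
    exact this
  have hh : h ∈ ω := ((hmem h).2 (Or.inl rfl)).1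
  have hh' : h' ∉ ω := fun hx => by
    rcases (hmem h').1 ⟨hx, fun hm => hm.2 (Or.inr rfl)⟩ with h1 | h1
    · exact hne h1
    · exact hu' h1
  have hωM : ∀ p, p ∈ ω → p ∉ M → p ∈ u₀ := fun p hp hq => by
    rcases (hmem p).1 ⟨hp, fun hm => hq hm.1⟩ with h1 | h1
    · exact absurd (h1 ▸ hhM) hq
    · exact h1
  have hu₀ : ∀ p, p ∈ u₀ → p ∈ ω ∧ p ∉ M := fun p hp =>
    ⟨((hmem p).2 (Or.inr hp)).1, fun hpM => hd.le_bot ⟨hp, hpM⟩⟩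
  have hω' : ω \ M = u₀ := by
    ext p
    constructor
    · rintro ⟨hp, hq⟩; exact hωM p hp hq
    · intro hp; exact hu₀ p hp
  obtain ⟨-, s2⟩ := quotParallel_sets_id hd hhM hh'M hω' hh hh'
  have hω'' : insert h' (ω \ {h}) \ M = u₀ := by
    ext p
    simp only [mem_sdiff, mem_insert_iff, mem_singleton_iff]
    constructor
    · rintro ⟨hp | ⟨hpω, -⟩, hpM⟩
      · exact absurd (hp ▸ hh'M) hpM
      · exact hωM p hpω hpM
    · intro hpu
      exact ⟨Or.inr ⟨(hu₀ p hpu).1, fun hp => hu (hp ▸ hpu)⟩, (hu₀ p hpu).2⟩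
  have hnot : h ∉ insert h' (ω \ {h}) := fun hx => by
    rcases mem_insert_iff.1 hx with hx | hx
    · exact hne hx.symm
    · exact hx.2 rfl
  obtain ⟨-, s4, -⟩ := quotParallel_sets_exch hd hhM hh'M hne hω'' hnot (mem_insert _ _)
  have s5 : insert h (insert h' (ω \ {h}) \ {h'}) = ω := by
    rw [insert_sdiff_self_of_notMem (fun hx => hh' hx.1), insert_sdiff_singleton, insert_eq_of_mem hh]
  rw [s5] at s4
  refine ⟨hh, hh', hω', ?_, hω'', s4.symm, s5⟩
  -- ω ∆ M = insert h' ((ω ∆ (M \ {h,h'})) \ {h})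
  rw [s2]
  have hhB : h ∉ (ω ∆ M) \ {h'} := fun hx => by
    rcases Set.mem_symmDiff.1 hx.1 with hx | hx
    · exact hx.2 hhM
    · exact hx.2 hh
  have hh'B : h' ∈ ω ∆ M := Set.mem_symmDiff.2 (Or.inr ⟨hh'M, hh'⟩)
  rw [insert_sdiff_self_of_notMem hhB, insert_sdiff_singleton, insert_eq_of_mem hh'B]

end Sets

/-! ### The halving identity -/

section Halving

variable {M u₀ : BondConfig V} {a₁ z₁ a₂ z₂ : V}

/-- **DOUBLE PAIRS HALVE.**  Two distinct free pairs `h = a₁z₁`, `h' = a₂z₂` parallel in the quotient (`a₁ ~ a₂`, `z₁ ~ z₂` pinned): for events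
`P, Q ⊆ Fo` invariant under the exchanges `h' ↔ h` in classes containing the pinned pairs,
`#_{(M,u₀)}(P, Q) = 2 · #_{(M ∖ {h,h'}, u₀ ∪ {h})}(P, Q)`. [cite: Linusson2011, Prop. 2.6] [cite: Grimmett2006, §1.5 (p. 13)] -/
theorem fibreCount_eq_two_mul_of_quotParallel (hd : Disjoint u₀ M) (hhM : s(a₁, z₁) ∈ M) (hh'M : s(a₂, z₂) ∈ M)
    (hne : s(a₂, z₂) ≠ s(a₁, z₁)) (ha : (openGraph u₀).Reachable a₁ a₂) (hz : (openGraph u₀).Reachable z₁ z₂) (h1 : a₁ ≠ z₁) (h2 : a₂ ≠ z₂)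
    {P Q : Set (BondConfig V)} (hPF : P ⊆ forestEv V) (hQF : Q ⊆ forestEv V)
    (hP1 : ∀ β, u₀ ⊆ β → s(a₂, z₂) ∈ β → s(a₁, z₁) ∉ β → β ∈ P → insert s(a₁, z₁) (β \ {s(a₂, z₂)}) ∈ P)
    (hP2 : ∀ β, u₀ ⊆ β → s(a₁, z₁) ∈ β → s(a₂, z₂) ∉ β → β ∈ P → insert s(a₂, z₂) (β \ {s(a₁, z₁)}) ∈ P)
    (hQ1 : ∀ β, u₀ ⊆ β → s(a₂, z₂) ∈ β → s(a₁, z₁) ∉ β → β ∈ Q → insert s(a₁, z₁) (β \ {s(a₂, z₂)}) ∈ Q)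
    (hQ2 : ∀ β, u₀ ⊆ β → s(a₁, z₁) ∈ β → s(a₂, z₂) ∉ β → β ∈ Q → insert s(a₂, z₂) (β \ {s(a₁, z₁)}) ∈ Q) :
    fibreCount M u₀ P Q = 2 * fibreCount (M \ {s(a₁, z₁), s(a₂, z₂)}) (insert s(a₁, z₁) u₀) P Q := by
  set h := s(a₁, z₁) with hhdef
  set h' := s(a₂, z₂) with hh'def
  have hu : h ∉ u₀ := fun hx => hd.le_bot ⟨hx, hhM⟩
  have hu' : h' ∉ u₀ := fun hx => hd.le_bot ⟨hx, hh'M⟩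
  have pin : ∀ ω : BondConfig V, ω \ M = u₀ → u₀ ⊆ ω := fun ω hω p hp => by
    have : p ∈ ω \ M := by rw [hω]; exact hp
    exact this.1
  have pinB : ∀ ω : BondConfig V, ω \ M = u₀ → u₀ ⊆ ω ∆ M := fun ω hω p hp =>
    Set.mem_symmDiff.2 (Or.inl ⟨pin ω hω hp, fun hpM => hd.le_bot ⟨hp, hpM⟩⟩)
  have freeB : ∀ ω : BondConfig V, ∀ g ∈ M, (g ∈ ω ∆ M ↔ g ∉ ω) := fun ω g hg => by
    rw [Set.mem_symmDiff]
    exact ⟨fun hx => hx.elim (fun hx => absurd hg hx.2) fun hx => hx.2, fun hx => Or.inr ⟨hg, hx⟩⟩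
  have hsplit : P = (P ∩ {ω | h ∈ ω}) ∪ (P ∩ {ω | h ∉ ω}) := by
    ext ω; simp only [mem_union, mem_inter_iff, mem_setOf_eq]; tauto
  conv_lhs => rw [hsplit]
  rw [fibreCount_split_left M u₀ Q (Set.disjoint_left.2 fun ω hx hy => hy.2 hx.2), two_mul]
  congr 1
  · -- `h ∈ ω`: identity map
    refine fibreCount_eq_of_bij id id (fun ω hω hA hB => ?_) (fun ω hω hA hB => ?_)
    · obtain ⟨hP, hhω⟩ := hA
      have hhω : h ∈ ω := hhω
      have hh'ω : h' ∉ ω := not_both_of_quotParallel (pin ω hω) (hPF hP) ha hz h1 h2 hne hu' hhω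
      obtain ⟨s1, s2⟩ := quotParallel_sets_id hd hhM hh'M hω hhω hh'ω
      refine ⟨s1, hP, ?_, rfl⟩
      show ω ∆ (M \ {h, h'}) ∈ Q
      rw [s2]
      have hh'B : h' ∈ ω ∆ M := (freeB ω h' hh'M).2 hh'ω
      have hhB : h ∉ ω ∆ M := fun hx => ((freeB ω h hhM).1 hx) hhω
      exact hQ1 _ (pinB ω hω) hh'B hhB hB
    · obtain ⟨hhω, hh'ω, s3, s4, -, -, -⟩ := quotParallel_sets_back hd hhM hh'M hne hω
      refine ⟨s3, ⟨hA, hhω⟩, ?_, rfl⟩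
      show ω ∆ M ∈ Q
      rw [s4]
      have hsubB : u₀ ⊆ ω ∆ (M \ {h, h'}) := fun p hp =>
        Set.mem_symmDiff.2 (Or.inl ⟨(pin ω s3) hp, fun hpM => hd.le_bot ⟨hp, hpM.1⟩⟩)
      have hhB : h ∈ ω ∆ (M \ {h, h'}) := Set.mem_symmDiff.2 (Or.inl ⟨hhω, fun hx => hx.2 (Or.inl rfl)⟩)
      have hh'B : h' ∉ ω ∆ (M \ {h, h'}) := fun hx => by
        rcases Set.mem_symmDiff.1 hx with hx | hx
        · exact hh'ω hx.1
        · exact hx.1.2 (Or.inr rfl)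
      exact hQ2 _ hsubB hhB hh'B hB
  · -- `h ∉ ω`: exchange in the first class
    refine fibreCount_eq_of_bij (fun ω => insert h (ω \ {h'})) (fun ω => insert h' (ω \ {h})) (fun ω hω hA hB => ?_)
      (fun ω hω hA hB => ?_)
    · obtain ⟨hP, hhω⟩ := hA
      have hhω : h ∉ ω := hhω
      have hhB : h ∈ ω ∆ M := (freeB ω h hhM).2 hhω
      have hh'B : h' ∉ ω ∆ M := not_both_of_quotParallel (pinB ω hω) (hQF hB) ha hz h1 h2 hne hu' hhB
      have hh'ω : h' ∈ ω := by by_contra hx; exact hh'B ((freeB ω h' hh'M).2 hx)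
      obtain ⟨s1, s2, s3⟩ := quotParallel_sets_exch hd hhM hh'M hne hω hhω hh'ω
      refine ⟨s1, hP1 _ (pin ω hω) hh'ω hhω hP, ?_, s3⟩
      show (insert h (ω \ {h'})) ∆ (M \ {h, h'}) ∈ Q
      rw [s2]; exact hB
    · obtain ⟨hhω, hh'ω, s3, -, s5, s6, s7⟩ := quotParallel_sets_back hd hhM hh'M hne hω
      refine ⟨s5, ⟨hP2 _ ((pin ω s3)) hhω hh'ω hA, fun hx => ?_⟩, ?_, s7⟩
      · rcases mem_insert_iff.1 hx with hx | hx
        · exact hne hx.symm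
        · exact hx.2 rfl
      · show (insert h' (ω \ {h})) ∆ M ∈ Q
        rw [s6]; exact hB

end Halving

/-! ### Exchange-invariance of the standard events and the halving of the one-class counts -/

section Standard

variable {u₀ : BondConfig V} {a₁ z₁ a₂ z₂ : V}

omit [Fintype V] in
/-- Undoing the exchange: for `h ∉ β ∋ h'`, `insert h' ((insert h (β ∖ h')) ∖ h) = β`. [folklore] -/
theorem exchange_undo {β : BondConfig V} {h h' : Sym2 V} (hh : h ∉ β) (hh' : h' ∈ β) :
    insert h' (insert h (β \ {h'}) \ {h}) = β := by
  rw [insert_sdiff_self_of_notMem (fun hx => hh hx.1), insert_sdiff_singleton, insert_eq_of_mem hh']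

omit [Fintype V] in
/-- Reachability events are exchange-invariant (both directions), for classes containing the pinned pairs. [cite: Grimmett2006, §1.5 (p. 13)] -/
theorem reach_iff_exchange_quotParallel {β : BondConfig V} (hsub : u₀ ⊆ β)
    (ha : (openGraph u₀).Reachable a₁ a₂) (hz : (openGraph u₀).Reachable z₁ z₂) (h1 : a₁ ≠ z₁) (h2 : a₂ ≠ z₂)
    (hu : s(a₁, z₁) ∉ u₀) (hu' : s(a₂, z₂) ∉ u₀) (hh : s(a₁, z₁) ∉ β) (hh' : s(a₂, z₂) ∈ β) (x w : V) :
    (openGraph β).Reachable x w ↔ (openGraph (insert s(a₁, z₁) (β \ {s(a₂, z₂)}))).Reachable x w := by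
  refine ⟨reachable_exchange_quotParallel hsub ha hz h1 hu' x w, fun hr => ?_⟩
  have hsub' : u₀ ⊆ insert s(a₁, z₁) (β \ {s(a₂, z₂)}) :=
    fun p hp => mem_insert_of_mem _ ⟨hsub hp, fun hx => hu' ((mem_singleton_iff.1 hx) ▸ hp)⟩
  have := reachable_exchange_quotParallel (a₁ := a₂) (z₁ := z₂) (a₂ := a₁) (z₂ := z₁) hsub' ha.symm hz.symm h2 hu x w hr
  rwa [exchange_undo hh hh'] at this

/-- **The four one-class counts at `(o,a)` halve** when a quotient-double pair `{h, h'}` (anywhere, `h, h' ∉ {e, f}`) is resolved: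
each of `sRR, sBB, dRB, dBR` on `(M, u₀)` equals twice the same count on `(M ∖ {h,h'}, u₀ ∪ {h})`.  (So `s_A(G) = 2·s_A(G/{h,h'})` — identity F4d.)
[cite: SempleWelsh2008, Conj. 1.1 (p. 2)] [cite: Linusson2011, Prop. 2.6] -/
theorem hubPair_counts_eq_two_mul_of_quotParallel {M : BondConfig V} {o v y a : V} (hd : Disjoint u₀ M)
    (hhM : s(a₁, z₁) ∈ M) (hh'M : s(a₂, z₂) ∈ M) (hne : s(a₂, z₂) ≠ s(a₁, z₁))
    (ha : (openGraph u₀).Reachable a₁ a₂) (hz : (openGraph u₀).Reachable z₁ z₂) (h1 : a₁ ≠ z₁) (h2 : a₂ ≠ z₂)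
    (he1 : s(a₁, z₁) ≠ s(o, v)) (he2 : s(a₂, z₂) ≠ s(o, v)) (hf1 : s(a₁, z₁) ≠ s(o, y)) (hf2 : s(a₂, z₂) ≠ s(o, y))
    (P₀ Q₀ : Set (BondConfig V))
    (hP₀ : P₀ ∈ ({univ, {ω | s(o, v) ∈ ω}, {ω | s(o, y) ∈ ω}, {ω | s(o, v) ∈ ω ∧ s(o, y) ∈ ω}} : Set (Set (BondConfig V))))
    (hQ₀ : Q₀ ∈ ({univ, {ω | s(o, v) ∈ ω}, {ω | s(o, y) ∈ ω}, {ω | s(o, v) ∈ ω ∧ s(o, y) ∈ ω}} : Set (Set (BondConfig V)))) :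
    fibreCount M u₀ (forestEv V ∩ P₀ ∩ {ω | (openGraph ω).Reachable o a}) (forestEv V ∩ Q₀ ∩ {ω | ¬ (openGraph ω).Reachable o a}) =
      2 * fibreCount (M \ {s(a₁, z₁), s(a₂, z₂)}) (insert s(a₁, z₁) u₀)
        (forestEv V ∩ P₀ ∩ {ω | (openGraph ω).Reachable o a}) (forestEv V ∩ Q₀ ∩ {ω | ¬ (openGraph ω).Reachable o a}) := by
  have hu : s(a₁, z₁) ∉ u₀ := fun hx => hd.le_bot ⟨hx, hhM⟩
  have hu' : s(a₂, z₂) ∉ u₀ := fun hx => hd.le_bot ⟨hx, hh'M⟩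
  have memInv : ∀ R₀ ∈ ({univ, {ω | s(o, v) ∈ ω}, {ω | s(o, y) ∈ ω}, {ω | s(o, v) ∈ ω ∧ s(o, y) ∈ ω}} : Set (Set (BondConfig V))),
      ∀ (β : BondConfig V) (g g' : Sym2 V), g ≠ s(o, v) → g ≠ s(o, y) → g' ≠ s(o, v) → g' ≠ s(o, y) →
        (β ∈ R₀ → insert g (β \ {g'}) ∈ R₀) := by
    intro R₀ hR₀ β g g' hg1 hg2 hg'1 hg'2 hβ
    have hev : s(o, v) ∈ β → s(o, v) ∈ insert g (β \ {g'}) := fun hx => mem_insert_of_mem _ ⟨hx, fun hx' => hg'1 (mem_singleton_iff.1 hx').symm⟩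
    have hfv : s(o, y) ∈ β → s(o, y) ∈ insert g (β \ {g'}) := fun hx => mem_insert_of_mem _ ⟨hx, fun hx' => hg'2 (mem_singleton_iff.1 hx').symm⟩
    simp only [mem_insert_iff, mem_singleton_iff] at hR₀
    rcases hR₀ with rfl | rfl | rfl | rfl
    · exact mem_univ _
    · exact hev hβ
    · exact hfv hβ
    · exact ⟨hev hβ.1, hfv hβ.2⟩
  refine fibreCount_eq_two_mul_of_quotParallel hd hhM hh'M hne ha hz h1 h2 (fun ω hω => hω.1.1) (fun ω hω => hω.1.1)
    (fun β hβ hin hout hP => ?_) (fun β hβ hin hout hP => ?_) (fun β hβ hin hout hQ => ?_) (fun β hβ hin hout hQ => ?_)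
  · exact ⟨⟨isForestCfg_exchange_quotParallel hβ hP.1.1 ha hz h1 h2 hu' hout hin, memInv P₀ hP₀ β _ _ he1 hf1 he2 hf2 hP.1.2⟩,
      (reach_iff_exchange_quotParallel hβ ha hz h1 h2 hu hu' hout hin o a).1 hP.2⟩
  · exact ⟨⟨isForestCfg_exchange_quotParallel (a₁ := a₂) (z₁ := z₂) (a₂ := a₁) (z₂ := z₁) hβ hP.1.1 ha.symm hz.symm h2 h1 hu hout hin,
      memInv P₀ hP₀ β _ _ he2 hf2 he1 hf1 hP.1.2⟩,
      (reach_iff_exchange_quotParallel (a₁ := a₂) (z₁ := z₂) (a₂ := a₁) (z₂ := z₁) hβ ha.symm hz.symm h2 h1 hu' hu hout hin o a).1 hP.2⟩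
  · exact ⟨⟨isForestCfg_exchange_quotParallel hβ hQ.1.1 ha hz h1 h2 hu' hout hin, memInv Q₀ hQ₀ β _ _ he1 hf1 he2 hf2 hQ.1.2⟩,
      fun hr => hQ.2 ((reach_iff_exchange_quotParallel hβ ha hz h1 h2 hu hu' hout hin o a).2 hr)⟩
  · exact ⟨⟨isForestCfg_exchange_quotParallel (a₁ := a₂) (z₁ := z₂) (a₂ := a₁) (z₂ := z₁) hβ hQ.1.1 ha.symm hz.symm h2 h1 hu hout hin,
      memInv Q₀ hQ₀ β _ _ he2 hf2 he1 hf1 hQ.1.2⟩,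
      fun hr => hQ.2 ((reach_iff_exchange_quotParallel (a₁ := a₂) (z₁ := z₂) (a₂ := a₁) (z₂ := z₁) hβ ha.symm hz.symm h2 h1 hu' hu
        hout hin o a).2 hr)⟩

end Standard

end FK
end Summit.CriticalPhenomena.PercolationContinuityZ3.Theorems

end
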